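import Literature.NumberTheory.Automorphic.KimExteriorSquareGL4ArchimedeanTwist
import Summits.Langlands.Langlands.Theorems.HalfIntegralTwistCM.Negative.ArchParameterGLOne
import HarnessLib

/-!
# `RegularTwistCM` (stmt-Langlands-14069) — negative lane IV: certificates for the six stubs of the
# lead's reshaped skeleton `petersson-hermitian-purity` @ fc20f4a48ad5 (cycle 4, `--supports`)

Sorry-free companion of `Cruxes/RegularTwistCM/Disproof.lean` §7 (cdisprove cycle 4). Nothing here
asserts a Theses decl (the route file is not imported). Contents:

* §1 the ADJOINT SHAPE of stub 1a (`stub_adjointArchShadowNonDihedral`): the multiplicative adjoint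
  `Ad β = ((β ×ˢ β).map (r.1 * r.2⁻¹)).erase 1` of the crux's hypothesis on a pair is `{X/Y, Y/X, 1}`
  (`ad_pair`), its additive form on `{x, y}` is `{x - y, y - x, 0}` (`addAd_pair`), the typed conclusion
  `{x - y + q, q, y - x + q}` of stub 1a is exactly the `q`-shift of the additive form (`adjointShape_eq`),
  symmetric in `x ↔ y` (`adjointShape_swap`, so well posed on the multiset `{x, y}`) and carried to the
  multiplicative adjoint by `exp` (`ad_pair_exp`): the reshaped conclusion has no sign/ordering slip;
* §2 the one-place content of stub 1b (`stub_dihedralVacuity`): an a.e. self-twist at an inert place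
  forces the shape `{X, -X}` (`selfTwist_pair_iff`) and then `Ad = {-1, -1, 1}` (`ad_pair_neg`) — a
  perfectly good local Satake datum, so the stub's negation is GLOBAL (Jacquet–Shalika II Thm 4.4) and
  admits no one-place counter-model;
* §3 stub 2 (`stub_descentInfinityType` = `exists_hasInfinityType`) has content ONLY at complex places:
  at embeddings fixed by conjugation the diagonal type `{(x, x)}` always works
  (`exists_hasInfinityType_of_conjugate_eq`, `…_of_isTotallyReal`);
* §4 stub 3 (`stub_centralCharacterDatum`) holds verbatim at `n = 1` (`centralCharacterDatum_glOne`) and,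
  as typed for general `n`, IMPLIES the sum pairing `∑ P(σ_w) - ∑ P(σ̄_w) ∈ ℤ` at every complex place
  (`sumPairing_of_centralCharacterDatum`) — true on paper (the central character is a character of
  `ℂˣ`), consistent with stub 2, and a cheap cross-check of the typed normalisation `{∑ P(ι)}`.
[folklore]
-/

set_option linter.dupNamespace false

noncomputable section

namespace Summit.Langlands.Langlands.Theorems.RegularTwistCM.Negative

open scoped BigOperators ComplexConjugate Classical
open NumberField Filter
open Literature.NumberTheory.Automorphic

/-! ## §1 The adjoint shape of stub 1a -/

/-- **The multiplicative adjoint of a pair**: for `X, Y ≠ 0`,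
`(({X, Y} ×ˢ {X, Y}).map (r.1 * r.2⁻¹)).erase 1 = {X/Y, Y/X, 1}` (the Satake datum of `Ad(σ₀,v)`,
Gelbart–Jacquet). [folklore] -/
theorem ad_pair (X Y : ℂ) (hX : X ≠ 0) (hY : Y ≠ 0) :
    ((({X, Y} : Multiset ℂ) ×ˢ ({X, Y} : Multiset ℂ)).map (fun r : ℂ × ℂ => r.1 * r.2⁻¹)).erase 1 =
      {X * Y⁻¹, Y * X⁻¹, 1} := by
  simp [Multiset.insert_eq_cons, mul_inv_cancel₀ hX, mul_inv_cancel₀ hY]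
  rw [Multiset.cons_swap (X * Y⁻¹) 1, Multiset.erase_cons_head]

/-- **The additive adjoint of a pair**: `(({x, y} ×ˢ {x, y}).map (r.1 - r.2)).erase 0 = {x - y, y - x, 0}`
(the Harish-Chandra datum of `Ad` at one embedding). [folklore] -/
theorem addAd_pair (x y : ℂ) :
    ((({x, y} : Multiset ℂ) ×ˢ ({x, y} : Multiset ℂ)).map (fun r : ℂ × ℂ => r.1 - r.2)).erase 0 =
      {x - y, y - x, 0} := by
  simp [Multiset.insert_eq_cons]
  rw [Multiset.cons_swap (x - y) 0, Multiset.erase_cons_head]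

/-- **Stub 1a's typed conclusion is the `q`-shift of the additive adjoint**:
`{x - y + q, q, y - x + q} = ((({x, y} ×ˢ {x, y}).map (r.1 - r.2)).erase 0).map (· + q)`. [folklore] -/
theorem adjointShape_eq (x y q : ℂ) :
    ({x - y + q, q, y - x + q} : Multiset ℂ) =
      (((({x, y} : Multiset ℂ) ×ˢ ({x, y} : Multiset ℂ)).map (fun r : ℂ × ℂ => r.1 - r.2)).erase 0).map
        (· + q) := by
  rw [addAd_pair]
  simp only [Multiset.insert_eq_cons, Multiset.map_cons, Multiset.map_singleton, zero_add]
  exact congrArg _ (Multiset.cons_swap q (y - x + q) 0)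

/-- **Well-posedness on the multiset**: the conclusion of stub 1a is symmetric in `x ↔ y`
(`{x, y} = {y, x}` must give the same `χπ ι`). [folklore] -/
theorem adjointShape_swap (x y q : ℂ) :
    ({x - y + q, q, y - x + q} : Multiset ℂ) = {y - x + q, q, x - y + q} := by
  simp only [Multiset.insert_eq_cons]
  rw [Multiset.cons_swap (x - y + q) q, Multiset.cons_swap (y - x + q) q]
  exact congrArg _ (Multiset.cons_swap (x - y + q) (y - x + q) 0)

/-- **Degenerate case `x = y`** (`Ad{b, b} = {1, 1, 1}`): the conclusion collapses to `{q, q, q}`. [folklore] -/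
theorem adjointShape_diag (x q : ℂ) :
    ({x - x + q, q, x - x + q} : Multiset ℂ) = {q, q, q} := by
  simp

/-- **`exp` carries the additive adjoint to the multiplicative one**:
`Ad{e^x, e^y} = {e^{x-y}, e^{y-x}, e^0}` — the Satake/Harish-Chandra consistency of the reshaped stub
(unramified principal series `z ↦ q_v^{-s}` versus exponents `s`). [folklore] -/
theorem ad_pair_exp (x y : ℂ) :
    ((({Complex.exp x, Complex.exp y} : Multiset ℂ) ×ˢ ({Complex.exp x, Complex.exp y} : Multiset ℂ)).map
        (fun r : ℂ × ℂ => r.1 * r.2⁻¹)).erase 1 =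
      ({x - y, y - x, 0} : Multiset ℂ).map Complex.exp := by
  rw [ad_pair _ _ (Complex.exp_ne_zero x) (Complex.exp_ne_zero y)]
  simp only [Multiset.insert_eq_cons, Multiset.map_cons, Multiset.map_singleton, Complex.exp_sub,
    Complex.exp_zero, div_eq_mul_inv]

/-- **Central shadow of stub 1a** (`ω_π = ν³` at `∞`, the theme of the sibling crux `RegularAdjointLiftCM`'s
`Negative/CentreCube.lean`): the entries of the adjoint shape sum to `3q`. [folklore] -/
theorem adjointShape_sum (x y q : ℂ) : ({x - y + q, q, y - x + q} : Multiset ℂ).sum = 3 * q := by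
  simp only [Multiset.insert_eq_cons, Multiset.sum_cons, Multiset.sum_singleton]
  ring

/-- **What regularity of `π` gives and no more** (Disproof F14): the adjoint shape is `Nodup` iff
`x ≠ y` (`a_w ≠ 0`). [folklore] -/
theorem adjointShape_nodup_iff (x y q : ℂ) :
    ({x - y + q, q, y - x + q} : Multiset ℂ).Nodup ↔ x ≠ y := by
  constructor
  · intro h hxy
    subst hxy
    simp [Multiset.insert_eq_cons] at h
  · intro hxy
    have ha : x - y ≠ 0 := sub_ne_zero.mpr hxy
    simp only [Multiset.insert_eq_cons, Multiset.nodup_cons, Multiset.mem_cons,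
      Multiset.mem_singleton, Multiset.nodup_singleton, and_true, not_or]
    refine ⟨⟨?_, ?_⟩, ?_⟩ <;> intro h <;> apply ha <;>
      first | linear_combination h | linear_combination h / 2

/-- **What C-algebraicity of `π` gives** (Disproof F14): all three entries of the adjoint shape are
integral iff `x - y ∈ ℤ` AND `q ∈ ℤ` — the integrality of the `ν`-exponent `q` comes for free from the
middle entry but is never consumed by any line. [folklore] -/
theorem adjointShape_integral_iff (x y q : ℂ) :
    (∀ z ∈ ({x - y + q, q, y - x + q} : Multiset ℂ), ∃ k : ℤ, z = k) ↔
      (∃ k : ℤ, x - y = k) ∧ ∃ k : ℤ, q = k := by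
  constructor
  · intro h
    obtain ⟨k₁, hk₁⟩ := h (x - y + q) (by simp)
    obtain ⟨k₂, hk₂⟩ := h q (by simp)
    exact ⟨⟨k₁ - k₂, by push_cast; linear_combination hk₁ - hk₂⟩, k₂, hk₂⟩
  · rintro ⟨⟨k, hk⟩, l, hl⟩ z hz
    simp only [Multiset.insert_eq_cons, Multiset.mem_cons, Multiset.mem_singleton] at hz
    rcases hz with rfl | rfl | rfl
    · exact ⟨k + l, by push_cast; linear_combination hk + hl⟩
    · exact ⟨l, hl⟩
    · exact ⟨-k + l, by push_cast; linear_combination -hk + hl⟩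

/-! ## §2 The one-place content of stub 1b -/

/-- **Self-twist at an inert place forces the dihedral shape**: for `X ≠ 0`,
`{X, Y}.map ((-1) * ·) = {X, Y} ↔ Y = -X` (`quadraticSign = -1` at an inert place). [folklore] -/
theorem selfTwist_pair_iff (X Y : ℂ) (hX : X ≠ 0) :
    ({X, Y} : Multiset ℂ).map (fun a => (-1 : ℂ) * a) = {X, Y} ↔ Y = -X := by
  constructor
  · intro h
    simp only [Multiset.insert_eq_cons, Multiset.map_cons, Multiset.map_singleton, neg_one_mul] at h
    rw [Multiset.cons_eq_cons] at h
    rcases h with ⟨h1, -⟩ | ⟨-, cs, h2, h3⟩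
    · exfalso
      apply hX
      have : (2 : ℂ) * X = 0 := by linear_combination -h1
      simpa using this
    · rw [Multiset.singleton_eq_cons_iff] at h3
      exact h3.1
  · rintro rfl
    simp only [Multiset.insert_eq_cons, Multiset.map_cons, Multiset.map_singleton, neg_one_mul, neg_neg]
    exact Multiset.cons_swap (-X) X 0

/-- **The adjoint of the dihedral shape**: for `X ≠ 0`, `Ad{X, -X} = {-1, -1, 1}`; so under the crux's
relation the `GL₃` Satake datum at every inert place is `d_v · {-1, -1, 1}` — locally unobstructed (it is
the local component of `ν ⊗ (η_{L/K} ⊞ AI(θ/θᶜ))`); the obstruction is global (JS II Thm 4.4). [folklore] -/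
theorem ad_pair_neg (X : ℂ) (hX : X ≠ 0) :
    ((({X, -X} : Multiset ℂ) ×ˢ ({X, -X} : Multiset ℂ)).map (fun r : ℂ × ℂ => r.1 * r.2⁻¹)).erase 1 =
      {-1, -1, 1} := by
  rw [ad_pair X (-X) hX (neg_ne_zero.mpr hX)]
  simp [mul_inv_cancel₀ hX, inv_neg]

/-! ## §3 Stub 2 has content only at complex places -/

/-- **At conjugation-fixed embeddings the diagonal type always works**: if every embedding of `K` is
real (`conj ∘ σ = σ`), ANY automorphic `π` on `GL_n(𝔸_K)` with an archimedean parameter `χ` has the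
well-formed infinity type `σ ↦ {(x, x) : x ∈ χ σ}` — `exists_hasInfinityType` carries no pairing
information at real places; over a CM field (the crux) ALL of its content is the integral pairing
`χ σ ↔ χ σ̄` at the complex places. [folklore] -/
theorem exists_hasInfinityType_of_conjugate_eq {n : ℕ} {K : Type} [Field K] [NumberField K]
    {hcpt : isCompact_glFiniteIntegralLevel n K}
    (hK : ∀ σ : K →+* ℂ, NumberField.ComplexEmbedding.conjugate σ = σ)
    {π : AutomorphicRepData (AutomorphyDatum.gl n K hcpt)} {χ : (K →+* ℂ) → Multiset ℂ}
    (h : π.HasArchParameter χ) : π.exists_hasInfinityType := by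
  refine ⟨fun σ => (χ σ).map (fun x => (⟨x, x, 0, by simp⟩ : ArchWeight)), ⟨fun σ => ?_, fun σ => ?_⟩, ?_⟩
  · rw [Multiset.card_map]
    exact AutomorphicRepData.card_eq_of_hasArchParameter h σ
  · rw [hK σ, Multiset.map_map]
    rfl
  · have hfun : (fun σ => ((χ σ).map (fun x => (⟨x, x, 0, by simp⟩ : ArchWeight))).map ArchWeight.a) = χ := by
      funext σ
      rw [Multiset.map_map]
      conv_rhs => rw [← Multiset.map_id (χ σ)]
      rfl
    rw [hfun]
    exact h

/-- **Totally real fields**: `exists_hasInfinityType` is equivalent to the bare existence of an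
archimedean parameter. [folklore] -/
theorem exists_hasInfinityType_of_isTotallyReal {n : ℕ} {K : Type} [Field K] [NumberField K]
    [NumberField.IsTotallyReal K] {hcpt : isCompact_glFiniteIntegralLevel n K}
    {π : AutomorphicRepData (AutomorphyDatum.gl n K hcpt)} {χ : (K →+* ℂ) → Multiset ℂ}
    (h : π.HasArchParameter χ) : π.exists_hasInfinityType := by
  refine exists_hasInfinityType_of_conjugate_eq (fun σ => ?_) h
  exact NumberField.ComplexEmbedding.isReal_iff.mp
    (NumberField.InfinitePlace.isReal_mk_iff.mp
      (NumberField.IsTotallyReal.isReal (NumberField.InfinitePlace.mk σ)))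

/-! ## §4 Stub 3: the `n = 1` instance and the sum pairing it implies -/

/-- **Stub 3 holds verbatim at `n = 1`**: a `GL₁` parameter has one entry per embedding
(`card_eq_of_hasArchParameter`), so `{∑ P(ι)} = P(ι)` and `ω := π` serves. [folklore] -/
theorem centralCharacterDatum_glOne (K : Type) [Field K] [NumberField K]
    (h1 hcpt : isCompact_glFiniteIntegralLevel 1 K) (π : CuspidalAutomorphicRepData 1 K hcpt)
    (P : (K →+* ℂ) → Multiset ℂ) (hP : π.1.HasArchParameter P) :
    ∃ ω : CuspidalAutomorphicRepData 1 K h1, ω.1.HasArchParameter (fun ι => {(P ι).sum}) := by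
  have hfun : (fun ι => ({(P ι).sum} : Multiset ℂ)) = P := by
    funext ι
    obtain ⟨x, hx⟩ := Multiset.card_eq_one.mp (AutomorphicRepData.card_eq_of_hasArchParameter hP ι)
    rw [hx, Multiset.sum_singleton]
  refine ⟨π, ?_⟩
  rw [hfun]
  exact hP

/-- **Stub 3, as typed for general `n`, implies the SUM PAIRING** `∑ P(σ_w) - ∑ P(σ̄_w) ∈ ℤ` at every
complex place `w`, for every cuspidal `π` on `GL_n(𝔸_K)` with a parameter `P` (the `GL₁` datum `ω`
it produces is a Hecke character line, `archParam_embedding_sub_conj_mem_int_glOne`). True on paper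
(central character restricted to `ℂˣ`); a typed normalisation `{∑ P(ι) + c_ι}` with `c_ι - c_ῑ ∉ ℤ`
would be exposed here. [folklore] -/
theorem sumPairing_of_centralCharacterDatum
    (h3 : ∀ (n : ℕ) [NeZero n] (K : Type) [Field K] [NumberField K]
      (h1 : isCompact_glFiniteIntegralLevel 1 K) (hcpt : isCompact_glFiniteIntegralLevel n K)
      (π : CuspidalAutomorphicRepData n K hcpt) (P : (K →+* ℂ) → Multiset ℂ), π.1.HasArchParameter P →
      ∃ ω : CuspidalAutomorphicRepData 1 K h1, ω.1.HasArchParameter (fun ι => {(P ι).sum}))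
    (n : ℕ) [NeZero n] (K : Type) [Field K] [NumberField K]
    (h1 : isCompact_glFiniteIntegralLevel 1 K) (hcpt : isCompact_glFiniteIntegralLevel n K)
    (π : CuspidalAutomorphicRepData n K hcpt) (P : (K →+* ℂ) → Multiset ℂ)
    (hP : π.1.HasArchParameter P) (w : {w : InfinitePlace K // w.IsComplex}) :
    ∃ m : ℤ, (P w.1.embedding).sum - (P (NumberField.ComplexEmbedding.conjugate w.1.embedding)).sum = m := by
  obtain ⟨ω, hω⟩ := h3 n K h1 hcpt π P hP
  obtain ⟨p, q, m, hp, hq, hm⟩ :=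
    Summit.Langlands.Langlands.Theorems.HalfIntegralTwistCM.Negative.archParam_embedding_sub_conj_mem_int_glOne
      ω.1 hω w
  refine ⟨m, ?_⟩
  rw [Multiset.singleton_inj] at hp hq
  rw [hp, hq, hm]

end Summit.Langlands.Langlands.Theorems.RegularTwistCM.Negative

end
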